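import Summits.KontsevichZagierPeriods.KontsevichZagierPeriods.Theorems.RootDecompRelativeModAbsoluteCylLogSplitP20

/-! # `RootDecompRelativeModAbsoluteCylLogSplitP21` — part 21/25 of the mechanical ≤330-line split of `CylLogSplit.lean`
(split by the decomp-kz census seat for landing; mathematics unchanged; part 21 continues part 20). -/

noncomputable section
open Set MeasureTheory Filter Topology
open scoped BigOperators
open Literature.NumberTheory.Transcendental Literature.ModelTheory.ExponentialFields

namespace Summit.KontsevichZagierPeriods.RootDecompRelativeModAbsolute.Rung30571

namespace RegularisedLogLayer

namespace CylLog
variable {b : ℕ}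

/-- **D7 in `LogStructure`'s currency (PROVED).**  One exact multiplicative relation `∏ W_i ^ (f i) = 1` with integer
exponents between ORIENTED semialgebraic differentiable positive units on an open ℚ-sa base `G`, the positive part
`∏ W_i ^ (f i)⁺` oriented on `G`, honest base bounds for the four oriented partial products: the signed sum
`Σ_i ε_i f_i • [cell_i]` (`ε_i = +1` for `W_i ≥ 1`, `−1` for the reversed cells `W_i ≤ 1`) of the `d·(t−1)^m/t`-cells
differs from the BASE TERM `[G, d · Σ_i f_i · polyLog_m (W_i)]` by an element of `KZ.relations`. -/
theorem regCells_mem_relations_of_zpow_rel {b m k : ℕ} {G : Set (Fin b → ℝ)} {d : (Fin b → ℝ) → ℝ}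
    (hGo : IsOpen G) (hG : IsSemialgebraic ℚ G) (hd : IsSemialgebraicFunOn ℚ G d)
    (W : Fin k → (Fin b → ℝ) → ℝ) (hW : ∀ i, IsSemialgebraicFunOn ℚ G (W i))
    (hWd : ∀ i, DifferentiableOn ℝ (W i) G) (σ : Fin k → Bool)
    (hσt : ∀ i, σ i = true → ∀ x ∈ G, 1 ≤ W i x)
    (hσf : ∀ i, σ i = false → ∀ x ∈ G, 0 < W i x ∧ W i x ≤ 1)
    (f : Fin k → ℤ) (hrel : ∀ x ∈ G, ∏ i, W i x ^ (f i) = 1)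
    (hL : (∀ x ∈ G, 1 ≤ ∏ i, W i x ^ (f i).toNat) ∨ (∀ x ∈ G, ∏ i, W i x ^ (f i).toNat ≤ 1))
    (hintU : IntegrableOn (fun x => d x * (∏ i, W i x ^ multUp f σ i - 1) ^ (m + 1)) G)
    (hintU' : IntegrableOn
      (fun x => d x * (1 - ∏ i, W i x ^ multUp' f σ i) ^ (m + 1) / ∏ i, W i x ^ multUp' f σ i) G)
    (hintV : IntegrableOn (fun x => d x * (∏ i, W i x ^ multDn f σ i - 1) ^ (m + 1)) G)
    (hintV' : IntegrableOn
      (fun x => d x * (1 - ∏ i, W i x ^ multDn' f σ i) ^ (m + 1) / ∏ i, W i x ^ multDn' f σ i) G)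
    (R : Fin k → KZ.IntegralRep (b + 1))
    (hRd : ∀ i, (R i).domain =
      if σ i then KZlog.band G (fun _ => 1) (W i) else KZlog.band G (W i) (fun _ => 1))
    (hRi : ∀ i, EqOn (R i).integrand
      (fun z => d (Fin.init z) * ((z (Fin.last b) - 1) ^ m / z (Fin.last b))) (R i).domain) :
    ∃ B : KZ.IntegralRep b, B.domain = G ∧
      (B.integrand = fun x => d x * ∑ i, (f i : ℝ) * polyLog m (W i x)) ∧
      ∑ i, (if σ i then f i else -f i) • KZ.of (R i) - KZ.of B ∈ KZ.relations := by
  have hW0 : ∀ i, ∀ x ∈ G, 0 < W i x := fun i x hx => by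
    cases h : σ i
    · exact (hσf i h x hx).1
    · linarith [hσt i h x hx]
  -- which side each expanded index lives on
  have keyU : ∀ j, σ (expandIdx (multUp f σ) j) = true := fun j => by
    have h := expandIdx_pos (multUp f σ) j
    by_contra hc
    simp [multUp, hc] at h
  have keyU' : ∀ j, σ (expandIdx (multUp' f σ) j) = false := fun j => by
    have h := expandIdx_pos (multUp' f σ) j
    by_contra hc
    simp [multUp', hc] at h
  have keyV : ∀ j, σ (expandIdx (multDn f σ) j) = true := fun j => by
    have h := expandIdx_pos (multDn f σ) j
    by_contra hc
    simp [multDn, hc] at h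
  have keyV' : ∀ j, σ (expandIdx (multDn' f σ) j) = false := fun j => by
    have h := expandIdx_pos (multDn' f σ) j
    by_contra hc
    simp [multDn', hc] at h
  -- the relation between the four partial products
  have hpos : ∀ x ∈ G, ∏ i, W i x ^ (f i).toNat = ∏ i, W i x ^ (-f i).toNat := fun x hx => by
    have hne : ∀ i, W i x ≠ 0 := fun i => (hW0 i x hx).ne'
    have h1 : ∏ i, W i x ^ (f i) = (∏ i, W i x ^ (f i).toNat) / ∏ i, W i x ^ (-f i).toNat := by
      rw [← Finset.prod_div_distrib]
      refine Finset.prod_congr rfl fun i _ => ?_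
      rw [← zpow_natCast, ← zpow_natCast, ← zpow_sub₀ (hne i), Int.toNat_sub_toNat_neg]
    have h2 : (∏ i, W i x ^ (-f i).toNat) ≠ 0 := Finset.prod_ne_zero_iff.mpr fun i _ => pow_ne_zero _ (hne i)
    have h3 := hrel x hx
    rw [h1, div_eq_one_iff_eq h2] at h3
    exact h3
  have hrel' : ∀ x ∈ G, (∏ j, W (expandIdx (multUp f σ) j) x) * ∏ j, W (expandIdx (multUp' f σ) j) x =
      (∏ j, W (expandIdx (multDn f σ) j) x) * ∏ j, W (expandIdx (multDn' f σ) j) x := fun x hx => by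
    rw [prod_expandIdx_apply, prod_expandIdx_apply, prod_expandIdx_apply, prod_expandIdx_apply,
      ← Finset.prod_mul_distrib, ← Finset.prod_mul_distrib]
    simp_rw [← pow_add, multUp_add_multUp', multDn_add_multDn']
    exact hpos x hx
  have hLeq : ∀ x ∈ G, (∏ j, W (expandIdx (multUp f σ) j) x) * ∏ j, W (expandIdx (multUp' f σ) j) x =
      ∏ i, W i x ^ (f i).toNat := fun x hx => by
    rw [prod_expandIdx_apply, prod_expandIdx_apply, ← Finset.prod_mul_distrib]
    simp_rw [← pow_add, multUp_add_multUp']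
  have hL' : (∀ x ∈ G, 1 ≤ (∏ j, W (expandIdx (multUp f σ) j) x) * ∏ j, W (expandIdx (multUp' f σ) j) x) ∨
      (∀ x ∈ G, (∏ j, W (expandIdx (multUp f σ) j) x) * ∏ j, W (expandIdx (multUp' f σ) j) x ≤ 1) := by
    rcases hL with h | h
    · exact Or.inl fun x hx => (hLeq x hx).symm ▸ h x hx
    · exact Or.inr fun x hx => (hLeq x hx).symm ▸ h x hx
  obtain ⟨B, hBd, hBi, hB⟩ := regCells_mem_relations_of_relation (m := m) hGo hG hd
    (fun j => W (expandIdx (multUp f σ) j)) (fun j => W (expandIdx (multUp' f σ) j))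
    (fun j => W (expandIdx (multDn f σ) j)) (fun j => W (expandIdx (multDn' f σ) j))
    (fun j => hW _) (fun j => hW _) (fun j => hW _) (fun j => hW _)
    (fun j => hWd _) (fun j => hWd _) (fun j => hWd _) (fun j => hWd _)
    (fun j x hx => hσt _ (keyU j) x hx) (fun j x hx => (hσf _ (keyU' j) x hx).1)
    (fun j x hx => (hσf _ (keyU' j) x hx).2)
    (fun j x hx => hσt _ (keyV j) x hx) (fun j x hx => (hσf _ (keyV' j) x hx).1)
    (fun j x hx => (hσf _ (keyV' j) x hx).2)
    hrel' hL'
    (by simpa only [prod_expandIdx_apply] using hintU) (by simpa only [prod_expandIdx_apply] using hintU')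
    (by simpa only [prod_expandIdx_apply] using hintV) (by simpa only [prod_expandIdx_apply] using hintV')
    (fun j => R (expandIdx (multUp f σ) j)) (fun j => R (expandIdx (multUp' f σ) j))
    (fun j => R (expandIdx (multDn f σ) j)) (fun j => R (expandIdx (multDn' f σ) j))
    (fun j => by rw [hRd, if_pos (keyU j)]) (fun j => hRi _)
    (fun j => by simp only [hRd, keyU' j]; rfl) (fun j => hRi _)
    (fun j => by rw [hRd, if_pos (keyV j)]) (fun j => hRi _)
    (fun j => by simp only [hRd, keyV' j]; rfl) (fun j => hRi _)
  -- rewrite the base integrand and the cell combination in the `f`-currency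
  have hsumR : ∀ x, (∑ j, polyLog m (W (expandIdx (multUp f σ) j) x) +
      ∑ j, polyLog m (W (expandIdx (multUp' f σ) j) x)) -
      (∑ j, polyLog m (W (expandIdx (multDn f σ) j) x) + ∑ j, polyLog m (W (expandIdx (multDn' f σ) j) x)) =
      ∑ i, (f i : ℝ) * polyLog m (W i x) := fun x => by
    rw [sum_expandIdx (multUp f σ) (fun i => polyLog m (W i x)),
      sum_expandIdx (multUp' f σ) (fun i => polyLog m (W i x)),
      sum_expandIdx (multDn f σ) (fun i => polyLog m (W i x)),
      sum_expandIdx (multDn' f σ) (fun i => polyLog m (W i x)),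
      ← Finset.sum_add_distrib, ← Finset.sum_add_distrib, ← Finset.sum_sub_distrib]
    refine Finset.sum_congr rfl fun i _ => ?_
    simp only [nsmul_eq_mul]
    rw [← add_mul, ← add_mul, ← sub_mul, ← Nat.cast_add, ← Nat.cast_add, multUp_add_multUp',
      multDn_add_multDn', toNat_sub_toNat_neg_real]
  have hsumC : (∑ j, KZ.of (R (expandIdx (multUp f σ) j)) - ∑ j, KZ.of (R (expandIdx (multUp' f σ) j))) -
      (∑ j, KZ.of (R (expandIdx (multDn f σ) j)) - ∑ j, KZ.of (R (expandIdx (multDn' f σ) j))) =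
      ∑ i, (if σ i then f i else -f i) • KZ.of (R i) := by
    rw [sum_expandIdx (multUp f σ) (fun i => KZ.of (R i)), sum_expandIdx (multUp' f σ) (fun i => KZ.of (R i)),
      sum_expandIdx (multDn f σ) (fun i => KZ.of (R i)), sum_expandIdx (multDn' f σ) (fun i => KZ.of (R i)),
      ← Finset.sum_sub_distrib, ← Finset.sum_sub_distrib, ← Finset.sum_sub_distrib]
    refine Finset.sum_congr rfl fun i _ => ?_
    rw [← mult_coef f σ i, sub_zsmul, sub_zsmul, sub_zsmul, natCast_zsmul, natCast_zsmul, natCast_zsmul,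
      natCast_zsmul]
    abel
  refine ⟨B, hBd, ?_, ?_⟩
  · rw [hBi]
    funext x
    rw [hsumR x]
  · rw [← hsumC]
    exact hB

/-! ### §3x D1 MADE MECHANICAL: common refinement of finitely many finite open partitions up to null sets, the
κ-sign partition and the smoothness partition (any base dimension) — PROVED -/

/-- Common refinement of TWO finite open ℚ-sa partitions of `G` up to null sets. -/
theorem exists_partition_inf {n N N' : ℕ} {G : Set (Fin n → ℝ)}
    (C : Fin N → Set (Fin n → ℝ)) (C' : Fin N' → Set (Fin n → ℝ))
    (hC : ∀ c, IsSemialgebraic ℚ (C c) ∧ IsOpen (C c) ∧ C c ⊆ G)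
    (hC' : ∀ c, IsSemialgebraic ℚ (C' c) ∧ IsOpen (C' c) ∧ C' c ⊆ G)
    (hdisj : Pairwise (Function.onFun Disjoint C)) (hdisj' : Pairwise (Function.onFun Disjoint C'))
    (hnull : volume (G \ ⋃ c, C c) = 0) (hnull' : volume (G \ ⋃ c, C' c) = 0) :
    ∃ D : Fin (N * N') → Set (Fin n → ℝ), (∀ e, IsSemialgebraic ℚ (D e) ∧ IsOpen (D e) ∧ D e ⊆ G) ∧
      Pairwise (Function.onFun Disjoint D) ∧ volume (G \ ⋃ e, D e) = 0 ∧
      ∀ e, ∃ c c', D e = C c ∩ C' c' := by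
  refine ⟨fun e => C (finProdFinEquiv.symm e).1 ∩ C' (finProdFinEquiv.symm e).2, fun e => ?_, ?_, ?_, fun e => ⟨_, _, rfl⟩⟩
  · exact ⟨(hC _).1.inter (hC' _).1, (hC _).2.1.inter (hC' _).2.1, fun x hx => (hC _).2.2 hx.1⟩
  · intro e e' hne
    have hp : finProdFinEquiv.symm e ≠ finProdFinEquiv.symm e' := fun h => hne (finProdFinEquiv.symm.injective h)
    rcases ne_or_eq (finProdFinEquiv.symm e).1 (finProdFinEquiv.symm e').1 with h1 | h1
    · exact (hdisj h1).mono inter_subset_left inter_subset_left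
    · have h2 : (finProdFinEquiv.symm e).2 ≠ (finProdFinEquiv.symm e').2 := fun h2 => hp (Prod.ext h1 h2)
      exact (hdisj' h2).mono inter_subset_right inter_subset_right
  · have hsub : G \ ⋃ e, C (finProdFinEquiv.symm e).1 ∩ C' (finProdFinEquiv.symm e).2 ⊆
        (G \ ⋃ c, C c) ∪ (G \ ⋃ c, C' c) := by
      intro x hx
      have hxG := hx.1
      have hno : ∀ e, x ∉ C (finProdFinEquiv.symm e).1 ∩ C' (finProdFinEquiv.symm e).2 :=
        fun e he => hx.2 (mem_iUnion.mpr ⟨e, he⟩)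
      by_cases h1 : x ∈ ⋃ c, C c
      · by_cases h2 : x ∈ ⋃ c, C' c
        · obtain ⟨c, hc⟩ := mem_iUnion.mp h1
          obtain ⟨c', hc'⟩ := mem_iUnion.mp h2
          exact (hno (finProdFinEquiv (c, c')) (by simpa using And.intro hc hc')).elim
        · exact Or.inr ⟨hxG, h2⟩
      · exact Or.inl ⟨hxG, h1⟩
    exact measure_mono_null hsub (measure_union_null hnull hnull')

/-- Common refinement of FINITELY MANY finite open ℚ-sa partitions of an open ℚ-sa `G` up to null sets. -/
theorem exists_common_refinement {n : ℕ} {G : Set (Fin n → ℝ)} (hGo : IsOpen G) (hG : IsSemialgebraic ℚ G) :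
    ∀ (q : ℕ) (N : Fin q → ℕ) (C : ∀ i, Fin (N i) → Set (Fin n → ℝ)),
      (∀ i c, IsSemialgebraic ℚ (C i c) ∧ IsOpen (C i c) ∧ C i c ⊆ G) →
      (∀ i, Pairwise (Function.onFun Disjoint (C i))) → (∀ i, volume (G \ ⋃ c, C i c) = 0) →
      ∃ M : ℕ, ∃ D : Fin M → Set (Fin n → ℝ), (∀ e, IsSemialgebraic ℚ (D e) ∧ IsOpen (D e) ∧ D e ⊆ G) ∧
        Pairwise (Function.onFun Disjoint D) ∧ volume (G \ ⋃ e, D e) = 0 ∧ ∀ e i, ∃ c, D e ⊆ C i c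
  | 0, N, C, _, _, _ => by
    refine ⟨1, fun _ => G, fun _ => ⟨hG, hGo, subset_rfl⟩, ?_, ?_, fun _ i => Fin.elim0 i⟩
    · intro i j hij
      exact absurd (Subsingleton.elim i j) hij
    · have h : G \ ⋃ _ : Fin 1, G = ∅ := by
        ext x
        simp
      rw [h, measure_empty]
  | q + 1, N, C, hC, hdisj, hnull => by
    obtain ⟨M, D, hD, hDd, hDn, hDr⟩ := exists_common_refinement hGo hG q (fun i => N i.castSucc)
      (fun i => C i.castSucc) (fun i c => hC _ c) (fun i => hdisj _) (fun i => hnull _)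
    obtain ⟨E, hE, hEd, hEn, hEr⟩ := exists_partition_inf D (C (Fin.last q)) hD (hC (Fin.last q)) hDd
      (hdisj (Fin.last q)) hDn (hnull (Fin.last q))
    refine ⟨M * N (Fin.last q), E, hE, hEd, hEn, fun e => ?_⟩
    obtain ⟨c, c', he⟩ := hEr e
    refine Fin.lastCases ⟨c', he ▸ inter_subset_right⟩ (fun i => ?_)
    obtain ⟨c₀, hc₀⟩ := hDr c i
    exact ⟨c₀, he ▸ inter_subset_left.trans hc₀⟩

/-- The κ-SIGN partition of D1: `G = {κ>0} ⊔ {κ<0} ⊔ {κ=0}° ⊔ null`. -/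
theorem exists_sign_partition {b : ℕ} {G : Set (Fin b → ℝ)} (hGo : IsOpen G) (hG : IsSemialgebraic ℚ G)
    {κ : (Fin b → ℝ) → ℝ} (hκ : IsSemialgebraicFunOn ℚ G κ) (hκc : ContinuousOn κ G) :
    ∃ C : Fin 3 → Set (Fin b → ℝ), (∀ c, IsSemialgebraic ℚ (C c) ∧ IsOpen (C c) ∧ C c ⊆ G) ∧
      Pairwise (Function.onFun Disjoint C) ∧ volume (G \ ⋃ c, C c) = 0 ∧
      (∀ x ∈ C 0, 0 < κ x) ∧ (∀ x ∈ C 1, κ x < 0) ∧ (∀ x ∈ C 2, κ x = 0) := by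
  have h1sa : IsSemialgebraicFunOn ℚ G (fun x => 1 + κ x) :=
    (IsSemialgebraicFunOn.add_holds (isSemialgebraicFunOn_ratCast hG 1) hκ).congr fun _ _ => by simp
  have h1c : ContinuousOn (fun x => 1 + κ x) G := continuousOn_const.add hκc
  obtain ⟨C, hC, hdisj, hnull, h0, h1, h2⟩ := exists_orientation_partition hGo hG h1sa h1c
  exact ⟨C, hC, hdisj, hnull, fun x hx => by linarith [h0 x hx], fun x hx => by linarith [h1 x hx],
    fun x hx => by linarith [h2 x hx]⟩

open scoped ContDiff in
/-- The SMOOTHNESS partition of D1 (one piece): a ℚ-sa function is `C^∞` on an open ℚ-sa subset of full measure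
(`KZ.exists_isOpen_contDiffOn`). -/
theorem exists_smooth_partition {b : ℕ} {G : Set (Fin b → ℝ)} (hG : IsSemialgebraic ℚ G)
    {v : (Fin b → ℝ) → ℝ} (hv : IsSemialgebraicFunOn ℚ G v) :
    ∃ C : Fin 1 → Set (Fin b → ℝ), (∀ c, IsSemialgebraic ℚ (C c) ∧ IsOpen (C c) ∧ C c ⊆ G) ∧
      Pairwise (Function.onFun Disjoint C) ∧ volume (G \ ⋃ c, C c) = 0 ∧ ContDiffOn ℝ ∞ v (C 0) := by
  obtain ⟨G', hG'G, hG'o, hG', hsm, -, hnull⟩ := KZ.exists_isOpen_contDiffOn hG hv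
  refine ⟨fun _ => G', fun _ => ⟨hG', hG'o, hG'G⟩, fun i j hij => absurd (Subsingleton.elim i j) hij, ?_, hsm⟩
  have h : G \ ⋃ _ : Fin 1, G' = G \ G' := by
    ext x
    simp
  rw [h]
  exact hnull

/-! ### §3y D2 MADE MECHANICAL: continuity of the fibre integral `κ ↦ ∫₀¹ θ^M/(1+θκ) dθ` on `(−1, ∞)` (dominated
convergence) and a.e.-zero ⇒ zero on open cells for continuous functions — PROVED -/

/-- The fibre integral `κ ↦ ∫₀¹ θ^M/(1+θκ) dθ` is continuous on `(−1, ∞)`. -/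
theorem continuousOn_fibreIntegral (M : ℕ) :
    ContinuousOn (fun κ : ℝ => ∫ θ in Set.Ioo (0:ℝ) 1, θ ^ M / (1 + θ * κ)) (Set.Ioi (-1)) := by
  intro κ₀ hκ₀
  refine ContinuousAt.continuousWithinAt ?_
  have hκ₀' : (-1 : ℝ) < κ₀ := hκ₀
  set κ₁ : ℝ := (κ₀ - 1) / 2 with hκ₁
  have hκ₁0 : -1 < κ₁ := by rw [hκ₁]; linarith
  have hκ₁1 : κ₁ < κ₀ := by rw [hκ₁]; linarith
  set c₀ : ℝ := min 1 (1 + κ₁) with hc₀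
  have hc₀pos : 0 < c₀ := lt_min one_pos (by linarith)
  have hden : ∀ κ, κ₁ < κ → ∀ θ ∈ Set.Ioo (0:ℝ) 1, c₀ ≤ 1 + θ * κ := by
    intro κ hκ θ hθ
    have h1 : θ * κ₁ ≤ θ * κ := by nlinarith [hθ.1]
    rcases le_or_gt 0 κ₁ with hk | hk
    · calc c₀ ≤ 1 := min_le_left _ _
        _ ≤ 1 + θ * κ := by nlinarith [hθ.1]
    · calc c₀ ≤ 1 + κ₁ := min_le_right _ _
        _ ≤ 1 + θ * κ₁ := by nlinarith [hθ.2]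
        _ ≤ 1 + θ * κ := by linarith
  have hpos : ∀ κ, κ₁ < κ → ∀ θ ∈ Set.Ioo (0:ℝ) 1, 0 < 1 + θ * κ := fun κ hκ θ hθ =>
    lt_of_lt_of_le hc₀pos (hden κ hκ θ hθ)
  have hnhds : ∀ᶠ κ in 𝓝 κ₀, κ₁ < κ := Ioi_mem_nhds hκ₁1
  haveI : IsFiniteMeasure (volume.restrict (Set.Ioo (0:ℝ) 1)) :=
    ⟨by rw [Measure.restrict_apply_univ]; exact measure_Ioo_lt_top⟩
  refine MeasureTheory.continuousAt_of_dominated (bound := fun _ => 1 / c₀) ?_ ?_ (integrable_const _) ?_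
  · filter_upwards [hnhds] with κ hκ
    have hc : ContinuousOn (fun θ : ℝ => θ ^ M / (1 + θ * κ)) (Set.Ioo 0 1) :=
      ContinuousOn.div (continuousOn_id.pow M) (continuousOn_const.add (continuousOn_id.mul continuousOn_const))
        fun θ hθ => (hpos κ hκ θ hθ).ne'
    exact hc.aestronglyMeasurable measurableSet_Ioo
  · filter_upwards [hnhds] with κ hκ
    refine ae_restrict_of_forall_mem measurableSet_Ioo fun θ hθ => ?_
    rw [norm_div, norm_pow, Real.norm_eq_abs, Real.norm_eq_abs, abs_of_pos hθ.1, abs_of_pos (hpos κ hκ θ hθ)]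
    calc θ ^ M / (1 + θ * κ) ≤ 1 / (1 + θ * κ) := by
          gcongr
          · exact (hpos κ hκ θ hθ).le
          · exact pow_le_one₀ hθ.1.le hθ.2.le
      _ ≤ 1 / c₀ := one_div_le_one_div_of_le hc₀pos (hden κ hκ θ hθ)
  · refine ae_restrict_of_forall_mem measurableSet_Ioo fun θ hθ => ?_
    have hne : 1 + θ * κ₀ ≠ 0 := (hpos κ₀ hκ₁1 θ hθ).ne'
    exact continuousAt_const.div (continuousAt_const.add (continuousAt_const.mul continuousAt_id)) hne

end CylLog
end RegularisedLogLayer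
end Summit.KontsevichZagierPeriods.RootDecompRelativeModAbsolute.Rung30571
end
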